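import Summits.AtomisticToContinuum.HydrodynamicLimit.Theorems.TwoClocksClampedEntropyClockTimeZeroReference
import Summits.AtomisticToContinuum.HydrodynamicLimit.Theorems.TwoClocksClampedWindowDockActivityInversion
import Summits.AtomisticToContinuum.HydrodynamicLimit.Theorems.CollisionIsometryCLTMacroClosureStubLedgerScaling
import HarnessLib

/-!
# Crux `ImplosionDichotomy.HydroLimitInBand` (stmt-AtomisticToContinuum-9133), line `IdeatorOneSketch`, stub G3: reference identification in band

Yau's relative-entropy clock for the crux runs along the EXPLICIT reference family of canonical local
Gibbs laws with activity `ρ_s · Rf(σ³ρ_s)` (`Rf` the insertion factor of the hard-sphere gas, handed over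
by the uniqueness of the root of `R' Φ(x R') = 1` in `[1/2, 2]`, `Φ(u) = Σ_j bE j uʲ/j!`). The guarded
Grönwall core of the line (`GronwallCoreInBand`) instead hands over, at time `t`, an ARBITRARY continuous
activity `a` with `ρ_t ≤ a ≤ 2ρ_t`, `SmallDensity (profileOf a) σ` and `rhoLim (profileOf a) σ = ρ_t`.
This file proves the registered stub `referenceIdentificationInBand` (G3) of the lead skeleton: whenever
`6 σ³ sup ρ_t < r`, both activities generate the SAME canonical local Gibbs law, for every velocity /
temperature field and every `N`. Three static steps, all landed elsewhere in the tree: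

1. UNIT MASS (`PolynomialCompressionStatics.integral_rhoLim_eq_one`): `∫ ρ_t = ∫ rhoLim Q σ = 1`
   (`Q = profileOf a`), hence `1 ≤ ∫ a` and `Q.M ≤ 2 sup ρ_t` (`EntropyClockDock.profileOf_M_le`), so the
   range condition `3 Q.M σ³ ≤ 6 σ³ sup ρ_t < r` of the EOS identity holds;
2. EOS IDENTITY (`QuenchedCellClock.rhoLim_mul_Rf_eq`): `ρ_t x · Rf(σ³ ρ_t x) = ratioLimit Q σ · Q.β x
   = (ratioLimit Q σ / ∫ a) · a x` — the two activities are proportional, with a positive constant;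
3. SCALE INVARIANCE of the canonical local Gibbs law (`MacroClosureLine.StubLedger.localGibbsLaw_const_mul`).

Worker file for the lead `prover-line-stmt-AtomisticToContinuum-9133-c1-0` (`--supports stmt-AtomisticToContinuum-9133`).
-/

noncomputable section

namespace Summit.AtomisticToContinuum.HydrodynamicLimit.Theorems.EntropyClockDock

open MeasureTheory Filter Set Topology
open Literature.MathematicalPhysics.KineticTheory Literature.Analysis.FluidPDE
open Summit.AtomisticToContinuum.HydrodynamicLimit.Theorems.PolynomialCompressionStatics

/-- **Stub G3 — reference identification in band.** Let `Rf x` be the unique root in `[1/2, 2]` of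
`R Φ(x R) = 1` for `x ∈ (-r, r)`. If a continuous activity `a` with `ρ ≤ a ≤ 2ρ` is in the statics regime
`SmallDensity (profileOf a) σ` with limit density `rhoLim (profileOf a) σ = ρ`, and `6 σ³ sup ρ < r`, then the
explicit activity `ρ · Rf(σ³ρ)` and `a` generate the same canonical local Gibbs law (for every velocity and
temperature field and every `N`): by unit mass of `rhoLim` one has `1 ≤ ∫ a`, so `(profileOf a).M ≤ 2 sup ρ`
and the EOS identity `rhoLim_mul_Rf_eq` applies, giving `ρ · Rf(σ³ρ) = (ratioLimit / ∫ a) · a`; the canonical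
law is invariant under that positive scale (`localGibbsLaw_const_mul`). [folklore] -/
theorem referenceIdentificationInBand :
    ∀ (r : ℝ) (Rf : ℝ → ℝ), 0 < r →
    (∀ x ∈ Set.Ioo (-r) r, ∀ R ∈ Set.Icc (1 / 2 : ℝ) 2,
      R * (∑' j : ℕ, bE j / (j.factorial : ℝ) * (x * R) ^ j) = 1 → R = Rf x) →
    ∀ σ : ℝ, 0 < σ → ∀ (ρ a : T3 → ℝ) (hac : Continuous a) (hap : ∀ x, 0 < a x),
      Continuous ρ → (∀ x, 0 < ρ x) →
      (∀ x, ρ x ≤ a x ∧ a x ≤ 2 * ρ x) → SmallDensity (profileOf a hac hap) σ →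
      rhoLim (profileOf a hac hap) σ = ρ → 6 * (σ ^ 3 * ⨆ x, ρ x) < r →
      ∀ (w : T3 → V3) (ϑ : T3 → ℝ) (N : ℕ)
        (Φ : HardSphereFlow (Torus.geometry (Fin 3)) (hsDiameter σ N) (N + 1)),
        localGibbsLaw σ (fun x => ρ x * Rf (σ ^ 3 * ρ x)) w ϑ N Φ = localGibbsLaw σ a w ϑ N Φ := by
  intro r Rf _hr huniq σ hσ ρ a hac hap hρc _hρ0 hale hQs hlim h6 w ϑ N Φ
  set Q := profileOf a hac hap with hQ
  -- step 1: unit mass of `ρ = rhoLim Q σ`, hence `1 ≤ ∫ a`, `Q.M ≤ 2 sup ρ` and `3 Q.M σ³ < r`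
  have hρ1 : ∫ x, ρ x = 1 := by
    rw [← hlim]
    exact integral_rhoLim_eq_one hQs
  have hinta : 1 ≤ ∫ x, a x := by
    have h := integral_mono (integrable_of_continuous_T3 hρc) (integrable_of_continuous_T3 hac)
      fun x => (hale x).1
    linarith [hρ1]
  have hI : 0 < ∫ y, a y := integral_pos_of_continuous_pos hac hap
  have hMQ : Q.M ≤ 2 * ⨆ x, ρ x := profileOf_M_le hac hap hρc (fun x => (hale x).2) hinta
  have hσ3 : 0 ≤ σ ^ 3 := pow_nonneg hσ.le 3
  have h3r : 3 * Q.M * σ ^ 3 < r :=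
    calc 3 * Q.M * σ ^ 3 ≤ 3 * (2 * ⨆ x, ρ x) * σ ^ 3 :=
          mul_le_mul_of_nonneg_right (mul_le_mul_of_nonneg_left hMQ (by norm_num)) hσ3
      _ = 6 * (σ ^ 3 * ⨆ x, ρ x) := by ring
      _ < r := h6
  -- step 2: the EOS identity `ρ · Rf(σ³ρ) = (ratioLimit Q σ / ∫ a) · a`
  have hrep := QuenchedCellClock.rhoLim_mul_Rf_eq huniq hQs h3r
  have hfun : (fun x => ρ x * Rf (σ ^ 3 * ρ x)) = fun x => ratioLimit Q σ / (∫ y, a y) * a x := by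
    funext x
    have h2 := (hrep x).2
    rw [hlim] at h2
    rw [h2, hQ, profileOf_β]
    ring
  have hc : 0 < ratioLimit Q σ / ∫ y, a y := div_pos hQs.ratioLimit_pos hI
  -- step 3: scale invariance of the canonical local Gibbs law
  rw [hfun]
  exact MacroClosureLine.StubLedger.localGibbsLaw_const_mul Φ a ϑ w hc

end Summit.AtomisticToContinuum.HydrodynamicLimit.Theorems.EntropyClockDock

end
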